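import Summits.AnomalousDissipation.AnomalousDissipation.Theorems.UniformResolution.Negative.ResolutionCriterion
import Summits.AnomalousDissipation.AnomalousDissipation.Theorems.UniformResolution.Negative.Shape

/-!
# `MomentParity.UniformResolution` (stmt-AnomalousDissipation-14330), line `Sketch`:
# de la Vallée-Poussin — ANY superlinear `N`-uniform moment of the enstrophy closes the bet `stub_loudUI`

Support file of the line lead (prover-line-stmt-AnomalousDissipation-14330-0). The line's only conjectural stub
`stub_loudUI` (skeleton `Cruxes/UniformResolution/Lines/Sketch.lean`) asks, at each viscosity `ν_j`, for a
sequence of laws with UNIFORMLY INTEGRABLE enstrophy which is `N`-frequently a loud Galerkin-invariant level-`N`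
law in one ball. This file records the sufficient ANALYTIC currency in the tree's vocabulary
(`UniformlyIntegrableEnstrophy` of `Negative/ResolutionCriterion.lean`): an `N`-uniform bound
`∫ Φ(‖∇u‖²) dμ_N ≤ C` for ONE superlinear `Φ` (de la Vallée-Poussin, sufficiency half) — e.g. `Φ(z) = z²`, i.e.
an `N`-uniform second moment of the enstrophy — over some loud invariant family gives the stub's conclusion with
UNCHANGED budgets. Every `N`-uniform estimate known for 3-D Galerkin-invariant laws at fixed `ν` (energy row,
Foias–Guillopé–Temam weighted `H²` bound, the FGT ladder) is scaling-critical, i.e. linear in `‖∇u‖²`; the gap to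
the crux is exactly one superlinear moment.

* `uniformlyIntegrableEnstrophy_of_superlinear` — superlinear moment bound over a family ⇒ uniform integrability.
* `uniformlyIntegrableEnstrophy_of_sq_moment` — the case `Φ(z) = z²`.
* `loudUI_of_superlinear_moment` — registered sub-goal of stmt-AnomalousDissipation-14330: loud invariant level-`N`
  laws, `N`-frequently, with a common superlinear moment bound at each `j` ⇒ the conclusion of `stub_loudUI` with
  `(E′, ε′) = (E, ε)`.
-/

noncomputable section

-- `Summit.<Summit>.<Problem>` duplicate namespace is the tree's mandated layout for single-conjunct summits.
set_option linter.dupNamespace false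

namespace Summit.AnomalousDissipation.AnomalousDissipation.Theorems.MomentParityUniformResolution

open MeasureTheory Filter Topology
open scoped ENNReal
open Literature.Analysis.FunctionSpaces Literature.Analysis.FluidPDE
open Summit.AnomalousDissipation.AnomalousDissipation.Theses.MomentParity
open Summit.AnomalousDissipation.AnomalousDissipation.Theorems.QuarticGate.Negative
open Summit.AnomalousDissipation.AnomalousDissipation.Theorems.UniformResolution.Negative
open Summit.AnomalousDissipation.AnomalousDissipation.Theorems.CubicParityLoud.Negative (L2T3)

/-- **de la Vallée-Poussin (sufficiency).** If `Φ : ℝ≥0∞ → ℝ≥0∞` grows superlinearly — for every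
finite slope `c` there is a finite level beyond which `c·z ≤ Φ(z)` — and `∫ Φ(‖∇u‖²) dμ ≤ C < ∞` uniformly over a
family of laws on `H`, then the family has uniformly integrable enstrophy: on `{‖∇u‖² > L}` one has
`n·‖∇u‖² ≤ Φ(‖∇u‖²)` for the slope `n > C/η`, so `∫_{‖∇u‖²>L} ‖∇u‖² ≤ C/n ≤ η`. [folklore] -/
theorem uniformlyIntegrableEnstrophy_of_superlinear {𝓕 : Set (Measure (Torus.energySpace (Fin 3)))}
    (Φ : ℝ≥0∞ → ℝ≥0∞)
    (hΦ : ∀ c : ℝ≥0∞, c ≠ ⊤ → ∃ L : ℝ≥0∞, L ≠ ⊤ ∧ ∀ z, L < z → c * z ≤ Φ z)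
    {C : ℝ≥0∞} (hC : C ≠ ⊤)
    (h : ∀ μ ∈ 𝓕, ∫⁻ u, Φ (Torus.eGradNormSq ((u.1 : L2T3) : UnitAddTorus (Fin 3) → EuclideanSpace ℝ (Fin 3))) ∂μ ≤ C) :
    UniformlyIntegrableEnstrophy 𝓕 := by
  intro η hη
  let eG : Torus.energySpace (Fin 3) → ℝ≥0∞ := fun u =>
    Torus.eGradNormSq ((u.1 : L2T3) : UnitAddTorus (Fin 3) → EuclideanSpace ℝ (Fin 3))
  have heG : Measurable eG := Torus.measurable_eGradNormSq_coe
  by_cases hηtop : η = ⊤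
  · exact ⟨0, ENNReal.zero_ne_top, fun μ _ => hηtop ▸ le_top⟩
  -- the slope n > C/η
  obtain ⟨n, hn⟩ := ENNReal.exists_nat_gt (ENNReal.div_ne_top hC hη.ne')
  have hn0 : (n : ℝ≥0∞) ≠ 0 := by
    intro h0; rw [h0] at hn; exact not_lt_zero hn
  have hCn : C ≤ (n : ℝ≥0∞) * η := ((ENNReal.div_lt_iff (Or.inl hη.ne') (Or.inl hηtop)).1 hn).le
  -- the level
  obtain ⟨L, hL, hLΦ⟩ := hΦ n (ENNReal.natCast_ne_top n)
  refine ⟨L, hL, fun μ hμ => ?_⟩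
  set S : Set (Torus.energySpace (Fin 3)) := {u | L < eG u} with hS_def
  have hS : MeasurableSet S := measurableSet_lt measurable_const heG
  -- n · ∫_S Z ≤ ∫ Φ(Z) ≤ C ≤ n η
  have hpt : ∀ u, (n : ℝ≥0∞) * S.indicator eG u ≤ Φ (eG u) := by
    intro u
    by_cases hu : u ∈ S
    · rw [Set.indicator_of_mem hu]
      exact hLΦ _ hu
    · rw [Set.indicator_of_notMem hu, mul_zero]
      exact zero_le
  have key : (n : ℝ≥0∞) * ∫⁻ u in S, eG u ∂μ ≤ (n : ℝ≥0∞) * η := by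
    calc (n : ℝ≥0∞) * ∫⁻ u in S, eG u ∂μ = ∫⁻ u, (n : ℝ≥0∞) * S.indicator eG u ∂μ := by
          rw [← lintegral_indicator hS, lintegral_const_mul _ (heG.indicator hS)]
      _ ≤ ∫⁻ u, Φ (eG u) ∂μ := lintegral_mono hpt
      _ ≤ C := h μ hμ
      _ ≤ (n : ℝ≥0∞) * η := hCn
  exact (ENNReal.mul_le_mul_iff_right hn0 (ENNReal.natCast_ne_top n)).1 key

/-- **Second moments suffice.** A family of laws on `H` with `∫ (‖∇u‖²)² dμ ≤ C < ∞` uniformly has uniformly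
integrable enstrophy (`Φ(z) = z²`: for `z > c`, `c·z ≤ z²`). [folklore] -/
theorem uniformlyIntegrableEnstrophy_of_sq_moment {𝓕 : Set (Measure (Torus.energySpace (Fin 3)))}
    {C : ℝ≥0∞} (hC : C ≠ ⊤)
    (h : ∀ μ ∈ 𝓕, ∫⁻ u, Torus.eGradNormSq ((u.1 : L2T3) : UnitAddTorus (Fin 3) → EuclideanSpace ℝ (Fin 3)) ^ 2 ∂μ ≤ C) :
    UniformlyIntegrableEnstrophy 𝓕 := by
  refine uniformlyIntegrableEnstrophy_of_superlinear (fun z => z ^ 2)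
    (fun c hc => ⟨c, hc, fun z hz => ?_⟩) hC h
  rw [sq]
  gcongr

/-- **ANY SUPERLINEAR `N`-UNIFORM MOMENT OF THE ENSTROPHY CLOSES THE BET** (registered sub-goal
`loudUI_of_superlinear_moment` of stmt-AnomalousDissipation-14330). If at every `j` there are a radius `R`, a
superlinear `Φ` and a finite `C` such that for infinitely many levels `N` some loud Galerkin-invariant
level-`N` law in the ball (polynomially stationary at every order, budgets `(E, ε)`) has `∫ Φ(‖∇u‖²) dμ ≤ C`,
then the conclusion of the line's stub `stub_loudUI` holds with the SAME budgets: a sequence of laws with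
uniformly integrable enstrophy (the chosen laws at the good levels, the zero measure elsewhere) which is
`N`-frequently a loud invariant level-`N` law in the ball. [folklore] -/
theorem loudUI_of_superlinear_moment : ∀ (f : UnitAddTorus (Fin 3) → EuclideanSpace ℝ (Fin 3)) (ν : ℕ → ℝ) (E ε : ℝ), (∀ j : ℕ, ∃ (R : ℝ) (Φ : ENNReal → ENNReal) (C : ENNReal), (∀ c : ENNReal, c ≠ ⊤ → ∃ L : ENNReal, L ≠ ⊤ ∧ ∀ z, L < z → c * z ≤ Φ z) ∧ C ≠ ⊤ ∧ ∃ᶠ N in Filter.atTop, ∃ μ : MeasureTheory.Measure (Literature.Analysis.FunctionSpaces.Torus.energySpace (Fin 3)), MeasureTheory.IsProbabilityMeasure μ ∧ (∀ᵐ u ∂μ, Summit.AnomalousDissipation.AnomalousDissipation.Theorems.QuarticGate.Negative.IsLevel N u) ∧ (∀ᵐ u ∂μ, ‖u‖ ≤ R) ∧ (∀ d : ℕ, Summit.AnomalousDissipation.AnomalousDissipation.Theorems.QuarticGate.Negative.IsPolyStationary (ν j) f N d μ) ∧ Literature.Analysis.FluidPDE.Torus.ensembleEnergy μ ≤ E ∧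 ε ≤ Literature.Analysis.FluidPDE.Torus.ensembleDissipation (ν j) μ ∧ MeasureTheory.lintegral μ (fun u => Φ (Literature.Analysis.FunctionSpaces.Torus.eGradNormSq (u.1 : UnitAddTorus (Fin 3) → EuclideanSpace ℝ (Fin 3)))) ≤ C) → ∀ j : ℕ, ∃ (R : ℝ) (μs : ℕ → MeasureTheory.Measure (Literature.Analysis.FunctionSpaces.Torus.energySpace (Fin 3))), Summit.AnomalousDissipation.AnomalousDissipation.Theorems.UniformResolution.Negative.UniformlyIntegrableEnstrophy (Set.range μs) ∧ ∃ᶠ N in Filter.atTop, MeasureTheory.IsProbabilityMeasure (μs N) ∧ (∀ᵐ u ∂(μs N), Summit.AnomalousDissipation.AnomalousDissipation.Theorems.QuarticGate.Negative.IsLevel N u) ∧ (∀ᵐ u ∂(μs N), ‖u‖ ≤ R) ∧ (∀ d : ℕ, Summit.AnomalousDissipation.AnomalousDissipation.Theorems.QuarticGate.Negative.IsPolyStationary (ν j) f N d (μs N)) ∧ Literature.Analysis.FluidPDE.Torus.ensembleEnergy (μs N) ≤ E ∧ ε ≤ Literature.Analysis.FluidPDE.Torus.ensembleDissipation (ν j)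 (μs N) := by
  intro f ν E ε hmom j
  obtain ⟨R, Φ, C, hΦ, hC, hfreq⟩ := hmom j
  classical
  -- the good levels and the chosen laws
  let good : ℕ → Prop := fun N => ∃ μ : Measure (Torus.energySpace (Fin 3)), IsProbabilityMeasure μ ∧
    (∀ᵐ u ∂μ, IsLevel N u) ∧ (∀ᵐ u ∂μ, ‖u‖ ≤ R) ∧ (∀ d : ℕ, IsPolyStationary (ν j) f N d μ) ∧
    Torus.ensembleEnergy μ ≤ E ∧ ε ≤ Torus.ensembleDissipation (ν j) μ ∧
    ∫⁻ u, Φ (Torus.eGradNormSq ((u.1 : L2T3) : UnitAddTorus (Fin 3) → EuclideanSpace ℝ (Fin 3))) ∂μ ≤ C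
  let μs : ℕ → Measure (Torus.energySpace (Fin 3)) := fun N =>
    if hN : good N then Classical.choose hN else 0
  have hμs_good : ∀ N (hN : good N), μs N = Classical.choose hN := fun N hN => dif_pos hN
  have hμs_bad : ∀ N, ¬ good N → μs N = 0 := fun N hN => dif_neg hN
  refine ⟨R, μs, ?_, ?_⟩
  · -- uniform integrability of the whole sequence
    refine uniformlyIntegrableEnstrophy_of_superlinear Φ hΦ hC ?_
    rintro μ ⟨N, rfl⟩
    by_cases hN : good N
    · rw [hμs_good N hN]
      exact (Classical.choose_spec hN).2.2.2.2.2.2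
    · rw [hμs_bad N hN, lintegral_zero_measure]
      exact zero_le
  · -- frequently a loud invariant level law
    refine hfreq.mono fun N hN => ?_
    have hg : good N := hN
    rw [hμs_good N hg]
    obtain ⟨hp, hl, hb, hst, hE, hD, -⟩ := Classical.choose_spec hg
    exact ⟨hp, hl, hb, hst, hE, hD⟩

end Summit.AnomalousDissipation.AnomalousDissipation.Theorems.MomentParityUniformResolution

end
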